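import Literature.Analysis.SegalBargmann.SchwartzTensorOperators
import HarnessLib

/-!
# The two-factor Schur lemma on transported carriers `𝓢(D₁)`, `𝓢(D₂)`, `𝓢(D)` (Folland 1989, §1.4/§1.7)

Topic `Analysis/SegalBargmann`; namespace `Literature.Analysis.SegalBargmann`.  The tensor-product operator
`tensorOp A₁ A₂` and the two-factor Schur lemma `exists_ne_zero_smul_tensorOp` (`SchwartzTensorOperators`) live on
Folland's carriers `𝓢(σ → ℝ, ℂ)`.  Consumers work on other finite-dimensional carriers (e.g. the archimedean factor
`𝓢((ι → K ⊗ ℝ), ℂ)` of an adelic Schwartz–Bruhat space); this file transports everything along real-linear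
isomorphisms `e₁ : D₁ ≃L ℝ^{σ₁}`, `e₂ : D₂ ≃L ℝ^{σ₂}`, `e : D ≃L ℝ^{σ₁ ⊕ σ₂}` (`schwartzTransport`, `rhoSD` of
`SchwartzCarrierTransport`):

* §1 the transported pure tensor `tensorD e₁ e₂ e f g := (e^*)⁻¹ (e₁^* f ⊠ e₂^* g)`; when `e` is COMPATIBLE with two
  projections `π_j : D → D_j` (`e₁ (π₁ x) = (e x) ∘ inl`, `e₂ (π₂ x) = (e x) ∘ inr`) this is the honest product
  `x ↦ f (π₁ x) g (π₂ x)` (`tensorD_apply_of_compatible`);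
* §2 the transported tensor operator `tensorOpD e₁ e₂ e A₁ A₂` with `tensorOpD (f ⊠ g) = A₁ f ⊠ A₂ g`, and continuous
  linear maps out of `𝓢(D)` are determined on transported pure tensors;
* §4 FUNCTION CARRIERS: for a real basis `b` of `V`, the coordinate isomorphisms `piCarrierEquiv b ι : (ι → V) ≃L
  (ι × τ → ℝ)` and `sumCarrierEquiv b ι₁ ι₂ : (ι₁ ⊕ ι₂ → V) ≃L ((ι₁ × τ) ⊕ (ι₂ × τ) → ℝ)` ARE compatible, the honest
  product `piBoxTensor f g x = f (x ∘ inl) g (x ∘ inr)` (`SchwartzMap.mulComp`) equals `tensorD`, and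
  `exists_ne_zero_smul_piBoxTensor` is the two-factor Schur lemma on `𝓢((ι₁ ⊕ ι₂) → V)` — the shape of the
  archimedean factor `𝓢((ι → K ⊗ ℝ), ℂ)` of an adelic Schwartz–Bruhat space;
* §3 **the two-factor Schur lemma on `𝓢(D)`**: a continuous automorphism `M` of `𝓢(D)` with
  `M ∘ rhoSD e (P,Q) = rhoSD e (blockPhase s₁ s₂ (P,Q)) ∘ M`, and automorphisms `A_j` of `𝓢(D_j)` with
  `A_j ∘ rhoSD e_j (p,q) = rhoSD e_j (s_j (p,q)) ∘ A_j`, satisfy `M (f ⊠ g) = c • (A₁ f ⊠ A₂ g)` for ONE `c ≠ 0`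
  (`exists_ne_zero_smul_tensorD`).

Everything is proved from the imported tree files; no cited statement is used as a hypothesis.

## References

* [Folland1989] G. B. Folland, *Harmonic Analysis in Phase Space*, Princeton UP (1989), §1.4 Prop. (1.43), §1.7.
  [cite: Folland1989, §1.7]

## Provenance

LEAN-IN-TREE rule (2026-08-18), pub-hodgecm model-construction sub-cell, seat mc-binder-2 gen 3 (node W2-⊗ (⊗S)-∞,
carrier transport asked for by the carvers, ruling R5 2026-08-18).
-/

set_option autoImplicit false

noncomputable section

open MeasureTheory Complex SchwartzMap Filter Topology
open scoped BigOperators Real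

namespace Literature.Analysis.SegalBargmann

local notation "SR" σ:max => (SchwartzMap (σ → ℝ) ℂ)
local notation "SD" D:max => (SchwartzMap D ℂ)

variable {σ₁ σ₂ : Type*} [Fintype σ₁] [Fintype σ₂]
variable {D₁ D₂ D : Type*} [NormedAddCommGroup D₁] [NormedSpace ℝ D₁] [NormedAddCommGroup D₂] [NormedSpace ℝ D₂]
  [NormedAddCommGroup D] [NormedSpace ℝ D]

/-! ## §1  Transported pure tensors -/

section TensorD

/-- **The transported pure tensor** `tensorD e₁ e₂ e f g := (e^*)⁻¹ (e₁^* f ⊠ e₂^* g) ∈ 𝓢(D)`. [folklore] -/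
def tensorD (e₁ : D₁ ≃L[ℝ] (σ₁ → ℝ)) (e₂ : D₂ ≃L[ℝ] (σ₂ → ℝ)) (e : D ≃L[ℝ] (σ₁ ⊕ σ₂ → ℝ))
    (f : SD D₁) (g : SD D₂) : SD D :=
  (schwartzTransport e).symm (tensorPi (schwartzTransport e₁ f) (schwartzTransport e₂ g))

variable (e₁ : D₁ ≃L[ℝ] (σ₁ → ℝ)) (e₂ : D₂ ≃L[ℝ] (σ₂ → ℝ)) (e : D ≃L[ℝ] (σ₁ ⊕ σ₂ → ℝ))

/-- `e^* (tensorD f g) = e₁^* f ⊠ e₂^* g`. [folklore] -/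
@[simp] theorem schwartzTransport_tensorD (f : SD D₁) (g : SD D₂) :
    schwartzTransport e (tensorD e₁ e₂ e f g) = tensorPi (schwartzTransport e₁ f) (schwartzTransport e₂ g) :=
  (schwartzTransport e).apply_symm_apply _

/-- Pointwise: `tensorD f g x = f (e₁⁻¹ ((e x) ∘ inl)) · g (e₂⁻¹ ((e x) ∘ inr))`. [folklore] -/
theorem tensorD_apply (f : SD D₁) (g : SD D₂) (x : D) :
    tensorD e₁ e₂ e f g x = f (e₁.symm (e x ∘ Sum.inl)) * g (e₂.symm (e x ∘ Sum.inr)) := by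
  rw [tensorD, schwartzTransport_symm_apply, tensorPi_apply, schwartzTransport_apply, schwartzTransport_apply]

/-- **Compatible coordinates give the honest product**: if `e₁ (π₁ x) = (e x) ∘ inl` and `e₂ (π₂ x) = (e x) ∘ inr`
then `tensorD f g x = f (π₁ x) · g (π₂ x)`. [folklore] -/
theorem tensorD_apply_of_compatible {π₁ : D → D₁} {π₂ : D → D₂} (h₁ : ∀ x, e₁ (π₁ x) = e x ∘ Sum.inl)
    (h₂ : ∀ x, e₂ (π₂ x) = e x ∘ Sum.inr) (f : SD D₁) (g : SD D₂) (x : D) :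
    tensorD e₁ e₂ e f g x = f (π₁ x) * g (π₂ x) := by
  rw [tensorD_apply, ← h₁, ← h₂, ContinuousLinearEquiv.symm_apply_apply, ContinuousLinearEquiv.symm_apply_apply]

/-- Bilinearity: additivity in the first factor. [folklore] -/
theorem tensorD_add_left (f f' : SD D₁) (g : SD D₂) :
    tensorD e₁ e₂ e (f + f') g = tensorD e₁ e₂ e f g + tensorD e₁ e₂ e f' g := by
  rw [tensorD, tensorD, tensorD, map_add, tensorPi_add_left, map_add]

/-- Additivity in the second factor. [folklore] -/
theorem tensorD_add_right (f : SD D₁) (g g' : SD D₂) :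
    tensorD e₁ e₂ e f (g + g') = tensorD e₁ e₂ e f g + tensorD e₁ e₂ e f g' := by
  rw [tensorD, tensorD, tensorD, map_add, tensorPi_add_right, map_add]

/-- Homogeneity in the first factor. [folklore] -/
theorem tensorD_smul_left (c : ℂ) (f : SD D₁) (g : SD D₂) :
    tensorD e₁ e₂ e (c • f) g = c • tensorD e₁ e₂ e f g := by
  rw [tensorD, tensorD, map_smul, tensorPi_smul_left, map_smul]

/-- Homogeneity in the second factor. [folklore] -/
theorem tensorD_smul_right (c : ℂ) (f : SD D₁) (g : SD D₂) :
    tensorD e₁ e₂ e f (c • g) = c • tensorD e₁ e₂ e f g := by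
  rw [tensorD, tensorD, map_smul, tensorPi_smul_right, map_smul]

/-- The transported Heisenberg operators factor on transported pure tensors. [cite: Folland1989, (1.25)] -/
theorem rhoSD_tensorD (p₁ q₁ : σ₁ → ℝ) (p₂ q₂ : σ₂ → ℝ) (f : SD D₁) (g : SD D₂) :
    rhoSD e (Sum.elim p₁ p₂) (Sum.elim q₁ q₂) (tensorD e₁ e₂ e f g) =
      tensorD e₁ e₂ e (rhoSD e₁ p₁ q₁ f) (rhoSD e₂ p₂ q₂ g) := by
  apply (schwartzTransport e).injective
  rw [schwartzTransport_rhoSD, schwartzTransport_tensorD, schwartzTransport_tensorD, rhoS_tensorPi,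
    schwartzTransport_rhoSD, schwartzTransport_rhoSD]

variable [DecidableEq σ₁] [DecidableEq σ₂]
variable {Y : Type*} [AddCommMonoid Y] [Module ℂ Y] [TopologicalSpace Y] [T2Space Y]

/-- **Continuous linear maps out of `𝓢(D)` are determined on transported pure tensors.** [cite: Folland1989, §1.7] -/
theorem clm_eq_of_eq_on_tensorD {S T : (SD D) →L[ℂ] Y}
    (h : ∀ (f : SD D₁) (g : SD D₂), S (tensorD e₁ e₂ e f g) = T (tensorD e₁ e₂ e f g)) : S = T := by
  have h' : S.comp ((schwartzTransport e).symm : (SR (σ₁ ⊕ σ₂)) →L[ℂ] SD D) =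
      T.comp ((schwartzTransport e).symm : (SR (σ₁ ⊕ σ₂)) →L[ℂ] SD D) := by
    refine clm_eq_of_eq_on_tensorPi fun f g => ?_
    have h1 := h ((schwartzTransport e₁).symm f) ((schwartzTransport e₂).symm g)
    simp only [tensorD, ContinuousLinearEquiv.apply_symm_apply] at h1
    exact h1
  refine ContinuousLinearMap.ext fun F => ?_
  have h2 := congrArg (fun R : (SR (σ₁ ⊕ σ₂)) →L[ℂ] Y => R (schwartzTransport e F)) h'
  simpa only [ContinuousLinearMap.comp_apply, ContinuousLinearEquiv.coe_coe,
    ContinuousLinearEquiv.symm_apply_apply] using h2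

end TensorD

/-! ## §2  The transported tensor operator -/

section TensorOpD

variable [DecidableEq σ₁] [DecidableEq σ₂]
variable (e₁ : D₁ ≃L[ℝ] (σ₁ → ℝ)) (e₂ : D₂ ≃L[ℝ] (σ₂ → ℝ)) (e : D ≃L[ℝ] (σ₁ ⊕ σ₂ → ℝ))

/-- Conjugation of a continuous operator of `𝓢(D')` to Folland's carrier: `e^* ∘ A ∘ (e^*)⁻¹`. [folklore] -/
def conjS {D' : Type*} [NormedAddCommGroup D'] [NormedSpace ℝ D'] {σ : Type*} [Fintype σ] (e' : D' ≃L[ℝ] (σ → ℝ))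
    (A : (SD D') →L[ℂ] SD D') : (SR σ) →L[ℂ] SR σ :=
  ((schwartzTransport e' : (SD D') →L[ℂ] SR σ).comp A).comp ((schwartzTransport e').symm : (SR σ) →L[ℂ] SD D')

/-- Unfolding. [folklore] -/
@[simp] theorem conjS_apply {D' : Type*} [NormedAddCommGroup D'] [NormedSpace ℝ D'] {σ : Type*} [Fintype σ]
    (e' : D' ≃L[ℝ] (σ → ℝ)) (A : (SD D') →L[ℂ] SD D') (f : SR σ) :
    conjS e' A f = schwartzTransport e' (A ((schwartzTransport e').symm f)) := rfl

/-- **The transported tensor operator** `tensorOpD A₁ A₂ := (e^*)⁻¹ ∘ (e₁^* A₁ (e₁^*)⁻¹ ⊠̂ e₂^* A₂ (e₂^*)⁻¹) ∘ e^*`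
on `𝓢(D)`. [cite: Folland1989, §1.7] -/
def tensorOpD (A₁ : (SD D₁) →L[ℂ] SD D₁) (A₂ : (SD D₂) →L[ℂ] SD D₂) : (SD D) →L[ℂ] SD D :=
  (((schwartzTransport e).symm : (SR (σ₁ ⊕ σ₂)) →L[ℂ] SD D).comp (tensorOp (conjS e₁ A₁) (conjS e₂ A₂))).comp
    (schwartzTransport e : (SD D) →L[ℂ] SR (σ₁ ⊕ σ₂))

/-- **`tensorOpD A₁ A₂ (f ⊠ g) = A₁ f ⊠ A₂ g`** on transported pure tensors. [cite: Folland1989, §1.7] -/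
theorem tensorOpD_tensorD (A₁ : (SD D₁) →L[ℂ] SD D₁) (A₂ : (SD D₂) →L[ℂ] SD D₂) (f : SD D₁) (g : SD D₂) :
    tensorOpD e₁ e₂ e A₁ A₂ (tensorD e₁ e₂ e f g) = tensorD e₁ e₂ e (A₁ f) (A₂ g) := by
  rw [tensorOpD, ContinuousLinearMap.comp_apply, ContinuousLinearMap.comp_apply, ContinuousLinearEquiv.coe_coe,
    ContinuousLinearEquiv.coe_coe, schwartzTransport_tensorD, tensorOp_tensorPi, conjS_apply, conjS_apply,
    ContinuousLinearEquiv.symm_apply_apply, ContinuousLinearEquiv.symm_apply_apply, tensorD]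

/-- Uniqueness of the extension on `𝓢(D)`. [folklore] -/
theorem eq_tensorOpD_of_apply_tensorD {A₁ : (SD D₁) →L[ℂ] SD D₁} {A₂ : (SD D₂) →L[ℂ] SD D₂}
    {T : (SD D) →L[ℂ] SD D} (hT : ∀ (f : SD D₁) (g : SD D₂), T (tensorD e₁ e₂ e f g) = tensorD e₁ e₂ e (A₁ f) (A₂ g)) :
    T = tensorOpD e₁ e₂ e A₁ A₂ :=
  clm_eq_of_eq_on_tensorD e₁ e₂ e fun f g => by rw [hT, tensorOpD_tensorD]

end TensorOpD

/-! ## §3  The two-factor Schur lemma on `𝓢(D)` -/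

section SchurD

variable [DecidableEq σ₁] [DecidableEq σ₂]
variable (e₁ : D₁ ≃L[ℝ] (σ₁ → ℝ)) (e₂ : D₂ ≃L[ℝ] (σ₂ → ℝ)) (e : D ≃L[ℝ] (σ₁ ⊕ σ₂ → ℝ))
variable {s₁ : (σ₁ → ℝ) × (σ₁ → ℝ) → (σ₁ → ℝ) × (σ₁ → ℝ)}
  {s₂ : (σ₂ → ℝ) × (σ₂ → ℝ) → (σ₂ → ℝ) × (σ₂ → ℝ)}

/-- Covariance transports: `A ρ_D(v) = ρ_D(s v) A` on `𝓢(D')` iff `e^* A (e^*)⁻¹ ρ(v) = ρ(s v) e^* A (e^*)⁻¹` on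
`𝓢(ℝ^σ)`. [folklore] -/
theorem conjS_rhoS {D' : Type*} [NormedAddCommGroup D'] [NormedSpace ℝ D'] {σ : Type*} [Fintype σ]
    (e' : D' ≃L[ℝ] (σ → ℝ)) {s : (σ → ℝ) × (σ → ℝ) → (σ → ℝ) × (σ → ℝ)} (A : (SD D') →L[ℂ] SD D')
    (hA : ∀ (p q : σ → ℝ) (f : SD D'), A (rhoSD e' p q f) = rhoSD e' (s (p, q)).1 (s (p, q)).2 (A f))
    (p q : σ → ℝ) (f : SR σ) :
    conjS e' A (rhoS p q f) = rhoS (s (p, q)).1 (s (p, q)).2 (conjS e' A f) := by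
  rw [conjS_apply, conjS_apply, schwartzTransport_symm_rhoS, hA, schwartzTransport_rhoSD]

/-- **Two-factor Schur lemma on transported carriers.** Let `M` be a continuous linear automorphism of `𝓢(D)`
with `M (ρ_D(P,Q) F) = ρ_D(blockPhase s₁ s₂ (P,Q)) (M F)` (`ρ_D = rhoSD e`), and `A_j` continuous linear automorphisms
of `𝓢(D_j)` with `A_j (ρ_{D_j}(p,q) f) = ρ_{D_j}(s_j (p,q)) (A_j f)`.  Then there is ONE scalar `c ≠ 0` with
`M = c • tensorOpD A₁ A₂`, in particular `M (f ⊠ g) = c • (A₁ f ⊠ A₂ g)` for all `f, g`.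
[cite: Folland1989, Prop. (1.43)] -/
theorem exists_ne_zero_smul_tensorD (M : (SD D) ≃L[ℂ] SD D)
    (hM : ∀ (P Q : σ₁ ⊕ σ₂ → ℝ) (F : SD D),
      M (rhoSD e P Q F) = rhoSD e (blockPhase s₁ s₂ (P, Q)).1 (blockPhase s₁ s₂ (P, Q)).2 (M F))
    (A₁ : (SD D₁) ≃L[ℂ] SD D₁) (A₂ : (SD D₂) ≃L[ℂ] SD D₂)
    (hA₁ : ∀ (p q : σ₁ → ℝ) (f : SD D₁), A₁ (rhoSD e₁ p q f) = rhoSD e₁ (s₁ (p, q)).1 (s₁ (p, q)).2 (A₁ f))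
    (hA₂ : ∀ (p q : σ₂ → ℝ) (g : SD D₂), A₂ (rhoSD e₂ p q g) = rhoSD e₂ (s₂ (p, q)).1 (s₂ (p, q)).2 (A₂ g)) :
    ∃ c : ℂ, c ≠ 0 ∧
      (∀ F, M F = c • tensorOpD e₁ e₂ e (A₁ : (SD D₁) →L[ℂ] SD D₁) (A₂ : (SD D₂) →L[ℂ] SD D₂) F) ∧
      ∀ (f : SD D₁) (g : SD D₂), M (tensorD e₁ e₂ e f g) = c • tensorD e₁ e₂ e (A₁ f) (A₂ g) := by
  -- conjugate everything to Folland's carriers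
  set M' : (SR (σ₁ ⊕ σ₂)) ≃L[ℂ] SR (σ₁ ⊕ σ₂) :=
    ((schwartzTransport e).symm.trans M).trans (schwartzTransport e) with hM'
  set A₁' : (SR σ₁) ≃L[ℂ] SR σ₁ := ((schwartzTransport e₁).symm.trans A₁).trans (schwartzTransport e₁) with hA₁'
  set A₂' : (SR σ₂) ≃L[ℂ] SR σ₂ := ((schwartzTransport e₂).symm.trans A₂).trans (schwartzTransport e₂) with hA₂'
  have hM'app : ∀ G, M' G = schwartzTransport e (M ((schwartzTransport e).symm G)) := fun G => rfl
  have hA₁'app : ∀ f, A₁' f = schwartzTransport e₁ (A₁ ((schwartzTransport e₁).symm f)) := fun f => rfl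
  have hA₂'app : ∀ g, A₂' g = schwartzTransport e₂ (A₂ ((schwartzTransport e₂).symm g)) := fun g => rfl
  have hA₁'c : (A₁' : (SR σ₁) →L[ℂ] SR σ₁) = conjS e₁ (A₁ : (SD D₁) →L[ℂ] SD D₁) :=
    ContinuousLinearMap.ext fun f => rfl
  have hA₂'c : (A₂' : (SR σ₂) →L[ℂ] SR σ₂) = conjS e₂ (A₂ : (SD D₂) →L[ℂ] SD D₂) :=
    ContinuousLinearMap.ext fun f => rfl
  have hM'cov : ∀ (P Q : σ₁ ⊕ σ₂ → ℝ) (G : SR (σ₁ ⊕ σ₂)),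
      M' (rhoS P Q G) = rhoS (blockPhase s₁ s₂ (P, Q)).1 (blockPhase s₁ s₂ (P, Q)).2 (M' G) := fun P Q G => by
    rw [hM'app, hM'app, schwartzTransport_symm_rhoS, hM, schwartzTransport_rhoSD]
  have hA₁'cov : ∀ (p q : σ₁ → ℝ) (f : SR σ₁),
      A₁' (rhoS p q f) = rhoS (s₁ (p, q)).1 (s₁ (p, q)).2 (A₁' f) := fun p q f => by
    rw [hA₁'app, hA₁'app, schwartzTransport_symm_rhoS, hA₁, schwartzTransport_rhoSD]
  have hA₂'cov : ∀ (p q : σ₂ → ℝ) (g : SR σ₂),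
      A₂' (rhoS p q g) = rhoS (s₂ (p, q)).1 (s₂ (p, q)).2 (A₂' g) := fun p q g => by
    rw [hA₂'app, hA₂'app, schwartzTransport_symm_rhoS, hA₂, schwartzTransport_rhoSD]
  obtain ⟨c, hc0, hcF, -⟩ := exists_ne_zero_smul_tensorOp M' hM'cov A₁' A₂' hA₁'cov hA₂'cov
  have key : ∀ F : SD D, M F = c • tensorOpD e₁ e₂ e (A₁ : (SD D₁) →L[ℂ] SD D₁) (A₂ : (SD D₂) →L[ℂ] SD D₂) F := by
    intro F
    have h1 := hcF (schwartzTransport e F)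
    rw [hM'app, ContinuousLinearEquiv.symm_apply_apply, hA₁'c, hA₂'c] at h1
    have h2 := congrArg (schwartzTransport e).symm h1
    rw [ContinuousLinearEquiv.symm_apply_apply, map_smul] at h2
    rw [h2, tensorOpD, ContinuousLinearMap.comp_apply, ContinuousLinearMap.comp_apply]
    rfl
  refine ⟨c, hc0, key, fun f g => ?_⟩
  rw [key, tensorOpD_tensorD]
  rfl

end SchurD

/-! ## §4  Function carriers `ι → V` in a real basis of `V` -/

section FunctionCarrier

variable {V : Type*} [NormedAddCommGroup V] [NormedSpace ℝ V] {τ : Type*} [Fintype τ] (b : Module.Basis τ ℝ V)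

/-- **Coordinates of `ι → V` in the basis `b`**: `(ι → V) ≃L[ℝ] (ι × τ → ℝ)`, `x ↦ ((i, t) ↦ b.repr (x i) t)`.
[folklore] -/
def piCarrierEquiv (ι : Type*) [Fintype ι] : (ι → V) ≃L[ℝ] (ι × τ → ℝ) :=
  haveI : FiniteDimensional ℝ V := Module.Finite.of_basis b
  ((LinearEquiv.piCongrRight fun _ : ι => b.equivFun).trans (LinearEquiv.curry ℝ ℝ ι τ).symm).toContinuousLinearEquiv

/-- Pointwise: `piCarrierEquiv b ι x (i, t) = b.repr (x i) t`. [folklore] -/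
@[simp] theorem piCarrierEquiv_apply {ι : Type*} [Fintype ι] (x : ι → V) (i : ι) (t : τ) :
    piCarrierEquiv b ι x (i, t) = b.repr (x i) t := rfl

/-- **Coordinates of `ι₁ ⊕ ι₂ → V`** regrouped as `((ι₁ × τ) ⊕ (ι₂ × τ) → ℝ)` (via `Equiv.sumProdDistrib`).
[folklore] -/
def sumCarrierEquiv (ι₁ ι₂ : Type*) [Fintype ι₁] [Fintype ι₂] :
    (ι₁ ⊕ ι₂ → V) ≃L[ℝ] ((ι₁ × τ) ⊕ (ι₂ × τ) → ℝ) :=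
  haveI : FiniteDimensional ℝ V := Module.Finite.of_basis b
  (((LinearEquiv.piCongrRight fun _ : ι₁ ⊕ ι₂ => b.equivFun).trans (LinearEquiv.curry ℝ ℝ (ι₁ ⊕ ι₂) τ).symm).trans
    (LinearEquiv.funCongrLeft ℝ ℝ (Equiv.sumProdDistrib ι₁ ι₂ τ).symm)).toContinuousLinearEquiv

variable {ι₁ ι₂ : Type*} [Fintype ι₁] [Fintype ι₂]

/-- Pointwise on the `ι₁`-block. [folklore] -/
@[simp] theorem sumCarrierEquiv_apply_inl (x : ι₁ ⊕ ι₂ → V) (i : ι₁) (t : τ) :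
    sumCarrierEquiv b ι₁ ι₂ x (Sum.inl (i, t)) = b.repr (x (Sum.inl i)) t := rfl

/-- Pointwise on the `ι₂`-block. [folklore] -/
@[simp] theorem sumCarrierEquiv_apply_inr (x : ι₁ ⊕ ι₂ → V) (j : ι₂) (t : τ) :
    sumCarrierEquiv b ι₁ ι₂ x (Sum.inr (j, t)) = b.repr (x (Sum.inr j)) t := rfl

/-- **Compatibility with the first projection**: `e₁ (x ∘ inl) = (e x) ∘ inl`. [folklore] -/
theorem piCarrierEquiv_comp_inl (x : ι₁ ⊕ ι₂ → V) :
    piCarrierEquiv b ι₁ (x ∘ Sum.inl) = sumCarrierEquiv b ι₁ ι₂ x ∘ Sum.inl := by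
  funext ⟨i, t⟩; rfl

/-- **Compatibility with the second projection**: `e₂ (x ∘ inr) = (e x) ∘ inr`. [folklore] -/
theorem piCarrierEquiv_comp_inr (x : ι₁ ⊕ ι₂ → V) :
    piCarrierEquiv b ι₂ (x ∘ Sum.inr) = sumCarrierEquiv b ι₁ ι₂ x ∘ Sum.inr := by
  funext ⟨j, t⟩; rfl

omit [Fintype τ] in
/-- The sup norm of `x : ι₁ ⊕ ι₂ → V` is controlled by its two restrictions. [folklore] -/
theorem norm_le_max_norm_restrict_pi (x : ι₁ ⊕ ι₂ → V) :
    ‖x‖ ≤ 1 * max ‖SchwartzMap.restrictCLM (E := V) Sum.inl x‖ ‖SchwartzMap.restrictCLM (E := V) Sum.inr x‖ := by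
  rw [one_mul, pi_norm_le_iff_of_nonneg (by positivity)]
  rintro (i | j)
  · exact (norm_le_pi_norm (x ∘ Sum.inl) i).trans (le_max_left _ _)
  · exact (norm_le_pi_norm (x ∘ Sum.inr) j).trans (le_max_right _ _)

/-- **The honest product of Schwartz functions in separate variables on `(ι₁ ⊕ ι₂) → V`**:
`piBoxTensor f g x = f (x ∘ inl) · g (x ∘ inr)` (the tree's `SchwartzMap.mulComp` along the two restrictions; for
`V = K ⊗ ℝ` this is literally the archimedean box tensor of the adelic Schwartz–Bruhat direct-sum vocabulary). [folklore] -/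
def piBoxTensor (f : SD (ι₁ → V)) (g : SD (ι₂ → V)) : SD (ι₁ ⊕ ι₂ → V) :=
  SchwartzMap.mulComp f g (SchwartzMap.restrictCLM (E := V) Sum.inl) (SchwartzMap.restrictCLM (E := V) Sum.inr)
    ⟨1, norm_le_max_norm_restrict_pi⟩

omit [Fintype τ] in
/-- Pointwise formula. [folklore] -/
@[simp] theorem piBoxTensor_apply (f : SD (ι₁ → V)) (g : SD (ι₂ → V)) (x : ι₁ ⊕ ι₂ → V) :
    piBoxTensor f g x = f (x ∘ Sum.inl) * g (x ∘ Sum.inr) := rfl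

/-- **The honest product IS the transported pure tensor** for the basis coordinates:
`piBoxTensor f g = tensorD (piCarrierEquiv b ι₁) (piCarrierEquiv b ι₂) (sumCarrierEquiv b ι₁ ι₂) f g`. [folklore] -/
theorem piBoxTensor_eq_tensorD (f : SD (ι₁ → V)) (g : SD (ι₂ → V)) :
    piBoxTensor f g = tensorD (piCarrierEquiv b ι₁) (piCarrierEquiv b ι₂) (sumCarrierEquiv b ι₁ ι₂) f g := by
  ext x
  rw [piBoxTensor_apply, tensorD_apply_of_compatible (piCarrierEquiv b ι₁) (piCarrierEquiv b ι₂)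
    (sumCarrierEquiv b ι₁ ι₂) (piCarrierEquiv_comp_inl b) (piCarrierEquiv_comp_inr b)]

variable {s₁ : (ι₁ × τ → ℝ) × (ι₁ × τ → ℝ) → (ι₁ × τ → ℝ) × (ι₁ × τ → ℝ)}
  {s₂ : (ι₂ × τ → ℝ) × (ι₂ × τ → ℝ) → (ι₂ × τ → ℝ) × (ι₂ × τ → ℝ)}

/-- **Two-factor Schur lemma on function carriers `𝓢((ι₁ ⊕ ι₂) → V)`**: a continuous linear automorphism `M`
covariant over the block-diagonal phase-space map (Heisenberg operators `rhoSD (sumCarrierEquiv b ι₁ ι₂)`), and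
automorphisms `A_j` of `𝓢(ι_j → V)` covariant over `s_j` (operators `rhoSD (piCarrierEquiv b ι_j)`), satisfy
`M (f ⊠ g) = c • (A₁ f ⊠ A₂ g)` for ONE `c ≠ 0` and all `f, g`, `⊠ = piBoxTensor`. [cite: Folland1989, Prop. (1.43)] -/
theorem exists_ne_zero_smul_piBoxTensor (M : (SD (ι₁ ⊕ ι₂ → V)) ≃L[ℂ] SD (ι₁ ⊕ ι₂ → V))
    (hM : ∀ (P Q : (ι₁ × τ) ⊕ (ι₂ × τ) → ℝ) (F : SD (ι₁ ⊕ ι₂ → V)),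
      M (rhoSD (sumCarrierEquiv b ι₁ ι₂) P Q F) =
        rhoSD (sumCarrierEquiv b ι₁ ι₂) (blockPhase s₁ s₂ (P, Q)).1 (blockPhase s₁ s₂ (P, Q)).2 (M F))
    (A₁ : (SD (ι₁ → V)) ≃L[ℂ] SD (ι₁ → V)) (A₂ : (SD (ι₂ → V)) ≃L[ℂ] SD (ι₂ → V))
    (hA₁ : ∀ (p q : ι₁ × τ → ℝ) (f : SD (ι₁ → V)),
      A₁ (rhoSD (piCarrierEquiv b ι₁) p q f) = rhoSD (piCarrierEquiv b ι₁) (s₁ (p, q)).1 (s₁ (p, q)).2 (A₁ f))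
    (hA₂ : ∀ (p q : ι₂ × τ → ℝ) (g : SD (ι₂ → V)),
      A₂ (rhoSD (piCarrierEquiv b ι₂) p q g) = rhoSD (piCarrierEquiv b ι₂) (s₂ (p, q)).1 (s₂ (p, q)).2 (A₂ g)) :
    ∃ c : ℂ, c ≠ 0 ∧ ∀ (f : SD (ι₁ → V)) (g : SD (ι₂ → V)),
      M (piBoxTensor f g) = c • piBoxTensor (A₁ f) (A₂ g) := by
  classical
  obtain ⟨c, hc0, -, h⟩ := exists_ne_zero_smul_tensorD (piCarrierEquiv b ι₁) (piCarrierEquiv b ι₂)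
    (sumCarrierEquiv b ι₁ ι₂) M hM A₁ A₂ hA₁ hA₂
  refine ⟨c, hc0, fun f g => ?_⟩
  rw [piBoxTensor_eq_tensorD b, piBoxTensor_eq_tensorD b, h]

end FunctionCarrier

end Literature.Analysis.SegalBargmann

end
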